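import Mathlib.AlgebraicGeometry.Morphisms.Proper
import Literature.AlgebraicGeometry.Morphisms.EtaleLiftDualNumber
import HarnessLib

/-!
# Properness descends along a surjective universally closed morphism: `i ≫ q` proper, `i` surjective ⇒ `q` proper;
# a flat/smooth lift over a nilpotent thickening of the base of a proper scheme is proper (EGA II 5.4.3, 5.4.6; Stacks 09ZZ / 0CEJ pattern)

Layer `Literature/AlgebraicGeometry/Morphisms`, namespace `Literature.AlgebraicGeometry.Morphisms`.  THEOREMS ONLY (no definition, no named fact,
no instance, no `sorry`).

§1 GENERAL.  For morphisms of schemes `i : X₀ ⟶ X`, `q : X ⟶ S` with `i` SURJECTIVE and UNIVERSALLY CLOSED (e.g. a surjective closed immersion —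
a nilpotent thickening):
* `isSeparated_of_comp_surjective` — `i ≫ q` separated ⇒ `q` separated: the diagonal `Δ_q` is an immersion (Mathlib) whose range
  `Δ_q(X) = Δ_q(i(X₀)) = (i ×_S i)(Δ_{i ≫ q}(X₀))` is closed (`Δ_{i≫q}` a closed immersion, `i ×_S i` universally closed), hence a closed
  immersion — the argument of [EGAII, Prop. 5.4.3 (i)⇒ proof] / the tree's `RelativeSpec.ActionOver.isSeparated_gluedDesc` (finite group quotients),
  written for a general pair `(i, q)`;
* `isProper_of_comp_surjective` — `i ≫ q` proper and `q` locally of finite type ⇒ `q` proper (universally closed by Mathlib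
  `UniversallyClosed.of_comp_surjective`; [EGAII, Cor. 5.4.3, Prop. 5.4.2 (ii)]).

§2 THE CONSUMER FORM (nilpotent thickenings of an affine base; [EGAII, Cor. 5.4.6]: «`f` propre ⟺ `f_red` propre»).  For a ring `A`, an ideal
`J ≤ nil(A)` (e.g. `J` nilpotent, or ANY proper ideal of an Artin local ring) and a CARTESIAN square `G : X₀ → X` over
`Spec (A⧸J) ↪ Spec A` with `X₀ → Spec (A⧸J)` proper and `X → Spec A` locally of finite type (e.g. smooth):
**`isProper_of_isPullback_specMap_quotientMk`** — `X → Spec A` is proper (`G` is a base change of the surjective closed immersion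
`Spec (A⧸J) → Spec A`, ★ `surjective_specMap_of_ker_le_nilradical`); Artin-local binder `isProper_of_isPullback_specMap_quotientMk_of_ne_top`
(`J ≠ ⊤`, the letter the F-11 lifting assemblers hold: the smooth lift `X'` of an abelian scheme `A₀` over `Spec (A⧸J)` IS proper, so that
[MumfordFogartyKirwan1994, Prop. 6.15] applies to it).

Cell `hodgecm-mathlib`, F-11 grandchild `F11LiftWithLineBundle` junction brick (B-p21 (S9) «properness of the glued lift», relieved to F0P1b-p06
by (R27)); consumers: the G1-(ii) / G2-(iii-d) assemblers and F-4 `stub_IIa`.  HC_CM is proved only modulo the 7 printed citations until rung 0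
closes; nothing here bears on a summit statement.  Mathlib searched (pin v4.32): `UniversallyClosed.of_comp_surjective`, `pullback.comp_diagonal`,
`MorphismProperty.pullbackMap`, `IsClosedImmersion.of_isPreimmersion`, `instIsImmersionDiagonal`, `IsClosedImmersion.spec_of_surjective`,
`MorphismProperty.of_isPullback`, `PrimeSpectrum.comap_quotientMk_bijective_of_le_nilradical`, `IsArtinianRing.isNilpotent_jacobson_bot`,
`IsLocalRing.jacobson_eq_maximalIdeal` (used); Mathlib has `IsSeparated.of_comp` / `IsProper` stability under composition and base change but
not this descent along a surjective universally closed first factor.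

## References
* [EGAII] A. Grothendieck, J. Dieudonné, EGA II (Publ. Math. IHÉS 8, 1961), Prop. 5.4.2 (ii), Cor. 5.4.3, Cor. 5.4.6.
* [StacksProject] The Stacks Project, Tag 01W0 (universally closed: `f ∘ i` with `i` surjective), Tag 01KV/01L1 (separated via the diagonal),
  Tag 0CEJ-type thickening statements.
* [MumfordFogartyKirwan1994] D. Mumford, J. Fogarty, F. Kirwan, *Geometric Invariant Theory*, 3rd ed. (1994), Ch. 6 §3 Prop. 6.15 (p. 124)
  (the consumer: «`π : X → S` smooth proper» for a lift over an Artin base).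
-/

noncomputable section

universe u

open CategoryTheory CategoryTheory.Limits AlgebraicGeometry

namespace Literature.AlgebraicGeometry.Morphisms

/-! ## §1 Descent of separatedness and properness along a surjective universally closed first factor -/

section General

variable {X₀ X S : Scheme.{u}} (i : X₀ ⟶ X) (q : X ⟶ S)

set_option backward.isDefEq.respectTransparency false in
/-- **`i ≫ q` separated, `i` surjective and universally closed ⇒ `q` separated.**  The diagonal `Δ_q` is an immersion with range
`Δ_q(X) = Δ_q(i(X₀)) = (i ×_S i)(range Δ_{i ≫ q})`, closed because `Δ_{i≫q}` is a closed immersion and `i ×_S i` is universally closed;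
an immersion with closed range is a closed immersion. [cite: EGAII, Prop. 5.4.2 (ii) and Cor. 5.4.3] -/
theorem isSeparated_of_comp_surjective [IsSeparated (i ≫ q)] [Surjective i] [UniversallyClosed i] : IsSeparated q := by
  haveI hUC : UniversallyClosed (pullback.map (i ≫ q) (i ≫ q) q q i i (𝟙 S)
      ((Category.comp_id _).trans rfl) ((Category.comp_id _).trans rfl)) :=
    MorphismProperty.pullbackMap (P := @UniversallyClosed) inferInstance inferInstance rfl rfl
  refine ⟨IsClosedImmersion.of_isPreimmersion _ ?_⟩
  have e1 : Set.range (pullback.diagonal q) = Set.range (i ≫ pullback.diagonal q) := by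
    rw [Scheme.Hom.comp_base, TopCat.coe_comp, Set.range_comp, i.surjective.range_eq, Set.image_univ]
  rw [e1, pullback.comp_diagonal, Scheme.Hom.comp_base, TopCat.coe_comp, Set.range_comp]
  exact (Scheme.Hom.isClosedMap _) _ (pullback.diagonal (i ≫ q)).isClosedEmbedding.isClosed_range

/-- **`i ≫ q` proper, `i` surjective and universally closed, `q` locally of finite type ⇒ `q` proper** (separated by
`isSeparated_of_comp_surjective`, universally closed by Mathlib `UniversallyClosed.of_comp_surjective`).
[cite: EGAII, Cor. 5.4.3 and Prop. 5.4.2 (ii)] -/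
theorem isProper_of_comp_surjective [IsProper (i ≫ q)] [Surjective i] [UniversallyClosed i] [LocallyOfFiniteType q] :
    IsProper q := by
  haveI := isSeparated_of_comp_surjective i q
  haveI := UniversallyClosed.of_comp_surjective i q
  exact {}

/-- The same with `i` a surjective CLOSED IMMERSION (a nilpotent thickening of `X`). [cite: EGAII, Cor. 5.4.6] -/
theorem isProper_of_comp_surjective_of_isClosedImmersion [IsProper (i ≫ q)] [Surjective i] [IsClosedImmersion i]
    [LocallyOfFiniteType q] : IsProper q :=
  isProper_of_comp_surjective i q

end General

/-! ## §2 Lifts over nilpotent thickenings of an affine base are proper -/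

section Thickening

variable {A : Type u} [CommRing A] {J : Ideal A} {X₀ X : Scheme.{u}} {q₀ : X₀ ⟶ Spec (.of (A ⧸ J))} {q : X ⟶ Spec (.of A)}
  {G : X₀ ⟶ X}

/-- `Spec (A⧸J) → Spec A` is surjective for `J ≤ nil(A)` (★ `surjective_specMap_of_ker_le_nilradical`). [cite: EGAII, Cor. 5.4.6] -/
theorem surjective_specMap_quotientMk_of_le_nilradical (hJ : J ≤ nilradical A) :
    Surjective (Spec.map (CommRingCat.ofHom (Ideal.Quotient.mk J))) :=
  surjective_specMap_of_ker_le_nilradical _ Ideal.Quotient.mk_surjective (by rwa [CommRingCat.hom_ofHom, Ideal.mk_ker])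

/-- A proper ideal of an Artin local ring is contained in the nilradical (it lies in the maximal ideal, which is the Jacobson radical
of `0`, nilpotent in an Artinian ring). [cite: EGAII, Cor. 5.4.6] -/
theorem le_nilradical_of_ne_top_of_isArtinianRing [IsArtinianRing A] [IsLocalRing A] (hJ : J ≠ ⊤) : J ≤ nilradical A := by
  have hnil : IsNilpotent (IsLocalRing.maximalIdeal A) := by
    rw [← IsLocalRing.jacobson_eq_maximalIdeal ⊥ bot_ne_top]
    exact IsArtinianRing.isNilpotent_jacobson_bot
  exact (IsLocalRing.le_maximalIdeal hJ).trans (le_nilradical_of_isNilpotent hnil)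

/-- **A lift over a nilpotent thickening of the base of a proper scheme is proper** ([EGAII, Cor. 5.4.6] «`f` propre ⟺ `f_red` propre»,
relative form): `J ≤ nil(A)`, a cartesian square `G : X₀ → X` over `Spec (A⧸J) ↪ Spec A`, `X₀ → Spec (A⧸J)` proper and `X → Spec A`
locally of finite type ⇒ `X → Spec A` proper.  (`G` is a base change of the surjective closed immersion `Spec (A⧸J) → Spec A`, and
`G ≫ q = q₀ ≫ Spec (A → A⧸J)` is proper.) [cite: EGAII, Cor. 5.4.6] [cite: MumfordFogartyKirwan1994, Ch. 6 §3 Proposition 6.15 (p. 124)] -/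
theorem isProper_of_isPullback_specMap_quotientMk (hJ : J ≤ nilradical A)
    (hG : IsPullback G q₀ q (Spec.map (CommRingCat.ofHom (Ideal.Quotient.mk J)))) [IsProper q₀] [LocallyOfFiniteType q] :
    IsProper q := by
  haveI : IsClosedImmersion (Spec.map (CommRingCat.ofHom (Ideal.Quotient.mk J))) :=
    IsClosedImmersion.spec_of_surjective _ Ideal.Quotient.mk_surjective
  haveI := surjective_specMap_quotientMk_of_le_nilradical hJ
  haveI : IsClosedImmersion G := MorphismProperty.of_isPullback hG.flip inferInstance
  haveI : Surjective G := MorphismProperty.of_isPullback hG.flip inferInstance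
  haveI : IsProper (G ≫ q) := by rw [hG.w]; infer_instance
  exact isProper_of_comp_surjective G q

/-- **The Artin-local letter**: `A` Artin local, `J ≠ ⊤`, a cartesian square `G : X₀ → X` over `Spec (A⧸J) ↪ Spec A` with `X₀` proper over
`Spec (A⧸J)` and `X` locally of finite type (e.g. smooth) over `Spec A` ⇒ `X → Spec A` is proper — the smooth lift of an abelian scheme over
an Artin base is proper, as [MumfordFogartyKirwan1994, Prop. 6.15] requires. [cite: MumfordFogartyKirwan1994, Ch. 6 §3 Proposition 6.15 (p. 124)]
[cite: EGAII, Cor. 5.4.6] -/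
theorem isProper_of_isPullback_specMap_quotientMk_of_ne_top [IsArtinianRing A] [IsLocalRing A] (hJ : J ≠ ⊤)
    (hG : IsPullback G q₀ q (Spec.map (CommRingCat.ofHom (Ideal.Quotient.mk J)))) [IsProper q₀] [LocallyOfFiniteType q] :
    IsProper q :=
  isProper_of_isPullback_specMap_quotientMk (le_nilradical_of_ne_top_of_isArtinianRing hJ) hG

end Thickening

end Literature.AlgebraicGeometry.Morphisms

end
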